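import Mathlib
import HarnessLib
import Summits.ValiantsHypothesis.ValiantsHypothesis.Theses.MonotoneRestoration
import Literature.Computability.AlgebraicComplexity.ArithCircuit
import Literature.Computability.AlgebraicComplexity.ArithCircuitProofs
import Literature.Computability.AlgebraicComplexity.MonotoneStructure
import Literature.Computability.AlgebraicComplexity.PermanentIrreducible
import Literature.ModelTheory.FiniteModelTheory.CkEquiv
import Summits.ValiantsHypothesis.ValiantsHypothesis.Theorems.MonotoneRestorationMonotoneRestorationQPCosetCount
import Summits.ValiantsHypothesis.ValiantsHypothesis.Theorems.MonotoneRestorationMonotoneRestorationQPSymmetricLB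
import Summits.ValiantsHypothesis.ValiantsHypothesis.Theorems.MonotoneRestorationMonotoneRestorationQPSupportSymmetrisation
import Summits.ValiantsHypothesis.ValiantsHypothesis.Theorems.MonotoneRestorationMonotoneRestorationQPSparseRegime
import Summits.ValiantsHypothesis.ValiantsHypothesis.Theorems.MonotoneRestorationMonotoneRestorationQPBeta
import Literature.Computability.AlgebraicComplexity.SymmetricArithCircuit
import Literature.Computability.AlgebraicComplexity.DawarWilsenach2025Proofs
import Literature.GroupTheory.PermutationGroups.SmallIndexSubgroups
import Summits.ValiantsHypothesis.ValiantsHypothesis.Theorems.MonotoneRestorationQP.Negative.LoadBearing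
import Summits.ValiantsHypothesis.ValiantsHypothesis.Theorems.MonotoneRestorationMonotoneRestorationQPPermSupportCount
import Summits.ValiantsHypothesis.ValiantsHypothesis.Theorems.MonotoneRestorationMonotoneRestorationQPMonotoneComputationOfComplexity

/-! TTRL-lite variant V18982 of stmt-ValiantsHypothesis-15886 -/

set_option linter.dupNamespace false

namespace Summit.ValiantsHypothesis.ValiantsHypothesis.Theorems

open Summit.ValiantsHypothesis.ValiantsHypothesis.Theses.MonotoneRestoration
open Literature.Computability.AlgebraicComplexity

/-- TTRL-lite variant V18982 (`σ := Fin 0`, no variables) of `stub_monotoneComputation_of_complexity`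
(stmt-ValiantsHypothesis-15886): every `f : MvPolynomial (Fin 0) ℝ≥0` has a Jerrum–Snir monotone
computation (fan-in two, all sum coefficients `1`) of size at most `3 · complexity f`. The degenerate
corner of the tree's `stub_monotoneComputation_of_complexity` (which holds for every index type `σ`):
each weighted sum gate `c • u + d • v` of a size-optimal fan-in-two circuit is expanded into
`(c ⊗ u) ⊕ (d ⊗ v)`, three new gates per old gate. [cite: JerrumSnir1982, §2.2] -/
theorem stub_monotoneComputation_of_complexity_var18982 :
    ∀ f : MvPolynomial (Fin 0) NNReal, ∃ P : ArithCircuit NNReal (Fin 0),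
      Literature.Barriers.ValiantsHypothesis.IsMonotoneComputation P f ∧
      P.size ≤ 3 * complexity f :=
  fun f => stub_monotoneComputation_of_complexity f

end Summit.ValiantsHypothesis.ValiantsHypothesis.Theorems
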